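import Summits.Ventures.HodgeRepro.Night1ProductWeilExceptional

/-!
# Divisorial or exceptional — the complete dichotomy on the kernel: the Weil space of a corner product
lies in the divisor-generated part iff the corners can be matched into complementary pairs, and otherwise
meets it only in `0`

Blind re-derivation cell `pub-hodge-repro`, seat `night-1` (gen 5, third file).  Imports night-1's
`Night1ProductWeilExceptional` (the divisor-generated part `divisorPower` / `divisorPowerIn`, the
concatenation `concatPairs` of pairs, `prod_ofFn_coordWedgeOn`, the line functionals on coordinate wedges,
`eq_compl_of_balanced_pair_on_line`).

`Night1ProductWeilExceptional` proved `W ⊓ D^k = 0` when NO two corners are complementary.  The route's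
S2 side (ROUTE.md §1 / §3.6: a conjugate pair `{T, T̄}` is a divisor class, `p = 1`) is the opposite extreme:
for a product of complementary pairs every Weil line is a product of balanced 2-wedges.  This file closes
the picture with one combinatorial invariant — a **complementary pairing** of the corners
(`HasComplPairing k T`: a bijection `Fin k × Fin 2 ≃ ι`, written as `concatPairs s`, with
`T (s j 1) = (T (s j 0))ᶜ` for every `j`):

* `concatPairs_comp` — concatenation commutes with post-composition;
* **`weilSpaceProd_le_divisorPowerIn_of_hasComplPairing`** — a complementary pairing makes every `σ`-line the
  product of the `k` balanced pairs `{(s j 0, σ), (s j 1, σ)}`, so `W ≤ D^k` (the lines are products of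
  divisor classes);
* **`hasComplPairing_of_lineDual_ne_zero`** — a product of `k` balanced pairs on which the `σ`-line functional
  does not vanish covers the `σ`-line, so its pairs, read on `ι`, are a complementary pairing; hence
  **`lineDual_eq_zero_of_mem_divisorPowerIn_of_not_hasComplPairing`** — without a complementary pairing
  every line functional kills `D^k`, and **`weilSpaceProd_inf_divisorPowerIn_eq_bot_of_not_hasComplPairing`**
  — `W ⊓ D^k = 0`;
* **`weilSpaceProd_le_divisorPowerIn_iff`** — `W ≤ D^k ↔ HasComplPairing k T`, and
  **`weilSpaceProd_le_divisorPowerIn_or_inf_eq_bot`** — THE DICHOTOMY: the Weil space of ANY corner family is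
  either contained in the divisor-generated part (divisorial) or meets it only in `0` (exceptional);
* `not_hasComplPairing_of_ne_compl` — no complementary corners ⇒ no pairing (`k ≥ 1`), recovering
  `Night1ProductWeilExceptional`'s theorem as the special case.

Reading (not a claim about varieties; NIGHT1.md §12): with `H¹(B, ℚ) = K^ι` and typer-2's dictionary, the
Weil classes of a corner product are generated by divisors exactly when the corners pair off into conjugate
pairs — the products of the route's S2 divisor classes — and in every other case NO nonzero Weil class is a
polynomial in divisor classes.  Nothing geometric is built; every statement is about coordinate wedges on
the finite `G`-set `ι × G`.  Nothing here says anything about the status of the Hodge conjecture for CM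
abelian varieties, which is NOT proved.
-/

set_option autoImplicit false

open Finset Module
open scoped Pointwise

namespace HodgeRepro.RouteC

open CMHodgeOn

/-! ### Concatenation commutes with post-composition -/

section Concat

variable {X Y : Type*}

/-- `concatPairs (f ∘ s) = f ∘ concatPairs s`. -/
theorem concatPairs_comp {k : ℕ} (f : X → Y) (s : Fin k → Fin 2 → X) :
    concatPairs (fun j b => f (s j b)) = f ∘ concatPairs s := by
  induction k with
  | zero =>
    funext a
    exact a.elim0
  | succ k ih =>
    funext a
    refine Fin.addCases (fun i => ?_) (fun i => ?_) a
    · simp [concatPairs, Fin.append_left, ih]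
    · simp [concatPairs, Fin.append_right]

end Concat

/-! ### Complementary pairings -/

section Pairing

variable {G : Type*} [Group G] [DecidableEq G] [Fintype G] {ι : Type*} [Fintype ι] [DecidableEq ι]

omit [Group G] [Fintype ι] [DecidableEq ι] in
/-- **A complementary pairing of the corners**: a bijection `Fin k × Fin 2 → ι` (as the concatenation of
`k` pairs) whose pairs are complementary corners, `T (s j 1) = (T (s j 0))ᶜ`. -/
def HasComplPairing (k : ℕ) (T : ι → Finset G) : Prop :=
  ∃ s : Fin k → Fin 2 → ι, Function.Bijective (concatPairs s) ∧ ∀ j, T (s j 1) = (T (s j 0))ᶜ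

/-- A corner is never its own complement (`G` is nonempty). -/
theorem ne_compl_self (Φ : Finset G) : Φ ≠ Φᶜ := by
  intro h
  have := Finset.ext_iff.1 h (1 : G)
  rw [mem_compl] at this
  exact (this.1 (this.2 fun hx => this.1 hx hx)) (this.2 fun hx => this.1 hx hx)

omit [Group G] [Fintype ι] [DecidableEq ι] in
/-- No two complementary corners ⇒ no complementary pairing (`k ≥ 1`). -/
theorem not_hasComplPairing_of_ne_compl {k : ℕ} (hk : 0 < k) (T : ι → Finset G)
    (hnc : ∀ i j, T j ≠ (T i)ᶜ) : ¬ HasComplPairing k T := by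
  rintro ⟨s, _, hpair⟩
  exact hnc _ _ (hpair ⟨0, hk⟩)

/-- The pair `{(i, σ), (i', σ)}` of two complementary corners is a balanced pair of the conjugate product
types: exactly one of `g⁻¹σ ∈ T i`, `g⁻¹σ ∈ T i'` holds. -/
theorem balanced_pair_of_eq_compl (T : ι → Finset G) {i i' : ι} (h : T i' = (T i)ᶜ) (σ g : G) :
    (univ.image (fun b : Fin 2 => (![i, i'] b, σ)) ∩ prodTypeSet fun i => g • T i).card = 1 := by
  have hne : i ≠ i' := by
    rintro rfl
    exact ne_compl_self (T i) h
  have hinj : Function.Injective fun b : Fin 2 => (![i, i'] b, σ) := by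
    intro a b hab
    have := congrArg Prod.fst hab
    fin_cases a <;> fin_cases b <;> simp_all
  rw [card_image_pair_inter_eq_one_iff hinj]
  simp only [prodTypeSet, mem_filter, mem_univ, true_and, Matrix.cons_val_zero, Matrix.cons_val_one,
    Matrix.cons_val_fin_one, h]
  rw [← Finset.inv_smul_mem_iff, ← Finset.inv_smul_mem_iff, mem_compl, not_not]

/-- **A complementary pairing makes the Weil space divisorial**: every `σ`-line is the product of the `k`
balanced 2-wedges of its pairs, hence lies in `D^k`. -/
theorem weilSpaceProd_le_divisorPowerIn_of_hasComplPairing {k : ℕ} (T : ι → Finset G)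
    (hp : HasComplPairing k T) (e : Fin (2 * k) ≃ ι) :
    weilSpaceProd G k e ≤ divisorPowerIn (fun g : G => prodTypeSet fun i => g • T i) k := by
  obtain ⟨s, hbij, hpair⟩ := hp
  -- re-enumerate through the pairing: the Weil space is canonical
  rw [weilSpaceProd_eq k (Equiv.ofBijective _ hbij) e, weilSpaceProd, Submodule.span_le]
  rintro _ ⟨τ, rfl⟩
  show weilWedgeProd (Equiv.ofBijective _ hbij) τ ∈
    divisorPowerIn (fun g : G => prodTypeSet fun i => g • T i) k
  rw [mem_divisorPowerIn_iff, divisorPower_eq_span]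
  refine Submodule.subset_span ?_
  rw [Set.mem_pow]
  -- the pairs `{(s j 0, τ), (s j 1, τ)}` as balanced 2-wedges
  refine ⟨fun j => ⟨(coordWedgeOn 2 fun b => (s j b, τ) : ExteriorAlgebra ℂ ((ι × G) → ℂ)), ?_⟩, ?_⟩
  · refine ⟨coordWedgeOn (2 * 1) fun b => (s j b, τ), ⟨fun b => (s j b, τ), ?_, fun g => ?_, rfl⟩, rfl⟩
    · intro a b hab
      have hab' := congrArg Prod.fst hab
      have hne : s j 0 ≠ s j 1 := by
        intro h
        exact ne_compl_self (T (s j 0)) (by rw [← hpair j, h])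
      fin_cases a <;> fin_cases b <;> simp_all
    · have := balanced_pair_of_eq_compl T (hpair j) τ g
      convert this using 3
      ext q
      simp only [mem_image, mem_univ, true_and]
      constructor
      · rintro ⟨b, rfl⟩
        exact ⟨b, by fin_cases b <;> rfl⟩
      · rintro ⟨b, rfl⟩
        exact ⟨b, by fin_cases b <;> rfl⟩
  · show (List.ofFn fun j => (coordWedgeOn 2 fun b => (s j b, τ) : ExteriorAlgebra ℂ ((ι × G) → ℂ))).prod = _
    rw [prod_ofFn_coordWedgeOn]
    congr 2
    funext a
    simp only [lineEnum, Equiv.ofBijective_apply]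
    rw [concatPairs_comp (fun i : ι => (i, τ)) s]
    rfl

end Pairing

/-! ### Without a complementary pairing the Weil space is exceptional -/

section Exceptional

variable {G : Type*} [Group G] [DecidableEq G] [Fintype G] {ι : Type*} [Fintype ι] [DecidableEq ι]

/-- **A product of balanced pairs that pairs non-trivially with the `σ`-line yields a complementary
pairing**: the concatenation covers the line, so, read on `ι`, the pairs are a bijection `Fin 2k → ι`
whose pairs are complementary corners. -/
theorem hasComplPairing_of_lineDual_ne_zero {k : ℕ} (e : Fin (2 * k) ≃ ι) (T : ι → Finset G) (σ : G)
    {t : Fin k → Fin 2 → ι × G} (hinj : ∀ j, Function.Injective (t j))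
    (hbal : ∀ j (g : G), (univ.image (t j) ∩ prodTypeSet fun i => g • T i).card = 1)
    (hne : lineDual e σ (coordWedgeOn (2 * k) (concatPairs t)) ≠ 0) : HasComplPairing k T := by
  have hcover := mem_range_of_lineDual_ne_zero e σ hne
  have hline := snd_eq_of_forall_mem_range e σ hcover
  refine ⟨fun j b => (t j b).1, ?_, fun j => ?_⟩
  · rw [show (fun j b => (t j b).1) = fun j b => Prod.fst (t j b) from rfl, concatPairs_comp Prod.fst t,
      Fintype.bijective_iff_surjective_and_card]
    refine ⟨fun i => ?_, Fintype.card_congr e⟩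
    obtain ⟨a, ha⟩ := hcover i
    exact ⟨a, by rw [Function.comp_apply, ha]⟩
  · have h0 : ∀ b, (t j b).2 = σ := by
      intro b
      obtain ⟨a, ha⟩ := (mem_range_concatPairs t _).2 ⟨j, b, rfl⟩
      rw [← ha]
      exact hline a
    exact eq_compl_of_balanced_pair_on_line T σ (hinj j) (hbal j) h0

/-- **Without a complementary pairing every line functional kills `D^k`** (the general form of
`lineDual_eq_zero_of_mem_divisorPowerIn`). -/
theorem lineDual_eq_zero_of_mem_divisorPowerIn_of_not_hasComplPairing {k : ℕ} (e : Fin (2 * k) ≃ ι)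
    (T : ι → Finset G) (hnp : ¬ HasComplPairing k T) (σ : G) {ω : ⋀[ℂ]^(2 * k) ((ι × G) → ℂ)}
    (hω : ω ∈ divisorPowerIn (fun g : G => prodTypeSet fun i => g • T i) k) :
    lineDual e σ ω = 0 := by
  rw [mem_divisorPowerIn_iff, divisorPower_eq_span] at hω
  have hP : ∃ ω' : ⋀[ℂ]^(2 * k) ((ι × G) → ℂ),
      (ω' : ExteriorAlgebra ℂ ((ι × G) → ℂ)) = (ω : ExteriorAlgebra ℂ ((ι × G) → ℂ)) ∧
        lineDual e σ ω' = 0 := by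
    refine Submodule.span_induction (p := fun x _ => ∃ ω' : ⋀[ℂ]^(2 * k) ((ι × G) → ℂ),
      (ω' : ExteriorAlgebra ℂ ((ι × G) → ℂ)) = x ∧ lineDual e σ ω' = 0) ?_ ?_ ?_ ?_ hω
    · intro x hx
      obtain ⟨f, hf⟩ := Set.mem_pow.1 hx
      have hf' : ∀ j : Fin k, ∃ s : Fin 2 → ι × G, Function.Injective s ∧
          (∀ g : G, (univ.image s ∩ prodTypeSet fun i => g • T i).card = 1) ∧
            (coordWedgeOn 2 s : ExteriorAlgebra ℂ ((ι × G) → ℂ)) =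
              (f j : ExteriorAlgebra ℂ ((ι × G) → ℂ)) := by
        intro j
        obtain ⟨ω₂, ⟨s, hs, hbal, hω₂⟩, hx₂⟩ := (f j).2
        exact ⟨s, hs, hbal, by rw [← hx₂, ← hω₂]; rfl⟩
      choose s hs hbal hfs using hf'
      refine ⟨coordWedgeOn (2 * k) (concatPairs s), ?_, ?_⟩
      · rw [← hf, ← prod_ofFn_coordWedgeOn]
        congr 2
        funext j
        exact hfs j
      · by_contra hne
        exact hnp (hasComplPairing_of_lineDual_ne_zero e T σ hs hbal hne)
    · exact ⟨0, by simp, map_zero _⟩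
    · rintro x y _ _ ⟨ω₁, h₁, h₁'⟩ ⟨ω₂, h₂, h₂'⟩
      exact ⟨ω₁ + ω₂, by simp [h₁, h₂], by rw [map_add, h₁', h₂', add_zero]⟩
    · rintro a x _ ⟨ω₁, h₁, h₁'⟩
      exact ⟨a • ω₁, by simp [h₁], by rw [map_smul, h₁', smul_zero]⟩
  obtain ⟨ω', h₁, h₂⟩ := hP
  rw [← Subtype.ext h₁]
  exact h₂

/-- **Without a complementary pairing the Weil space is exceptional** (`k ≥ 1`): `W ⊓ D^k = 0`. -/
theorem weilSpaceProd_inf_divisorPowerIn_eq_bot_of_not_hasComplPairing {k : ℕ} (hk : 0 < k)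
    (e : Fin (2 * k) ≃ ι) (T : ι → Finset G) (hnp : ¬ HasComplPairing k T) :
    weilSpaceProd G k e ⊓ divisorPowerIn (fun g : G => prodTypeSet fun i => g • T i) k = ⊥ := by
  rw [Submodule.eq_bot_iff]
  rintro ω ⟨hω, hD⟩
  by_contra h0
  obtain ⟨σ, hσ⟩ := exists_lineDual_ne_zero hk e hω h0
  exact hσ (lineDual_eq_zero_of_mem_divisorPowerIn_of_not_hasComplPairing e T hnp σ hD)

/-- **Divisorial iff pairable**: the Weil space lies in the divisor-generated part iff the corners admit a
complementary pairing. -/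
theorem weilSpaceProd_le_divisorPowerIn_iff {k : ℕ} (e : Fin (2 * k) ≃ ι) (T : ι → Finset G) :
    weilSpaceProd G k e ≤ divisorPowerIn (fun g : G => prodTypeSet fun i => g • T i) k ↔
      HasComplPairing k T := by
  refine ⟨fun h => ?_, fun hp => weilSpaceProd_le_divisorPowerIn_of_hasComplPairing T hp e⟩
  by_contra hnp
  have h1 := lineDual_eq_zero_of_mem_divisorPowerIn_of_not_hasComplPairing e T hnp 1
    (h (weilWedgeProd_mem_weilSpaceProd k e 1))
  rw [lineDual_weilWedgeProd_self] at h1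
  exact one_ne_zero h1

/-- **THE DICHOTOMY** (`k ≥ 1`): the Weil space of ANY corner family is either contained in the
divisor-generated part `D^k` (the corners pair off into complementary pairs) or meets it only in `0`. -/
theorem weilSpaceProd_le_divisorPowerIn_or_inf_eq_bot {k : ℕ} (hk : 0 < k) (e : Fin (2 * k) ≃ ι)
    (T : ι → Finset G) :
    weilSpaceProd G k e ≤ divisorPowerIn (fun g : G => prodTypeSet fun i => g • T i) k ∨
      weilSpaceProd G k e ⊓ divisorPowerIn (fun g : G => prodTypeSet fun i => g • T i) k = ⊥ := by
  by_cases hp : HasComplPairing k T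
  · exact Or.inl (weilSpaceProd_le_divisorPowerIn_of_hasComplPairing T hp e)
  · exact Or.inr (weilSpaceProd_inf_divisorPowerIn_eq_bot_of_not_hasComplPairing hk e T hp)

open scoped Classical in
/-- The rational form of the dichotomy: for a Galois CM field, either every rational Weil class is a
polynomial in divisor classes or no nonzero one is (`k ≥ 1`). -/
theorem forall_ratWeil_mem_or_forall_notMem (K : Type*) [Field K] [NumberField K] [IsGalois ℚ K]
    (φ₀ : K →+* ℂ) {k : ℕ} (hk : 0 < k) (e : Fin (2 * k) ≃ ι) (T : ι → Finset (K ≃ₐ[ℚ] K)) :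
    (∀ f : K, ratWeil K φ₀ e f ∈
        divisorPowerIn (fun g : K ≃ₐ[ℚ] K => prodTypeSet fun i => g • T i) k) ∨
      (∀ f : K, f ≠ 0 → ratWeil K φ₀ e f ∉
        divisorPowerIn (fun g : K ≃ₐ[ℚ] K => prodTypeSet fun i => g • T i) k) := by
  rcases weilSpaceProd_le_divisorPowerIn_or_inf_eq_bot hk e T with h | h
  · exact Or.inl fun f => h (ratWeil_mem_weilSpaceProd K φ₀ e f)
  · right
    intro f hf hD
    rw [Submodule.eq_bot_iff] at h
    exact ratWeil_ne_zero K φ₀ hk e hf (h _ ⟨ratWeil_mem_weilSpaceProd K φ₀ e f, hD⟩)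

end Exceptional

end HodgeRepro.RouteC
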